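import Literature.NumberTheory.Automorphic.PairLFunctionPolesRepDataRankTwo
import Literature.NumberTheory.Automorphic.PairLFunctionPolesEqConjOfHumphriesJo
import HarnessLib

/-!
# Arthur–Clozel (2.3) for Borel–Jacquet data from the Humphries–Jo archimedean fact in ranks `≥ 3`

Topic `NumberTheory/Automorphic`; namespace `Literature.NumberTheory.Automorphic`. Theorems only.

The named fact `JacquetShalika1981_partialPairL_pole_repData` (Arthur–Clozel (2.3) for cuspidal
automorphic representations given as Borel–Jacquet data: for cuspidal `π`, `σ` on `GL_n(𝔸_F)`,
unitary Satake families `α`, `β` off a finite `S ⊇ S₀` and `s₀ ∈ X` — `Re s₀ = 1`,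
`q_w^{1-s₀} t_{π,w} = t_{σ,w}⁻¹` for almost all `w` — the limit `lim_{s → s₀⁺} (s - s₀) L^S(s, π ⊗ σ)`
exists and is non-zero) is reduced in the tree to its `L²` leaf
`JacquetShalika1981_partialPairL_pole_of_eq_conj` rank by rank
(`JacquetShalika1981_partialPairL_pole_repData_rank`, `PairLFunctionPolesRepDataHolds`); the leaf is a
theorem in ranks `≤ 2` (`JacquetShalika1981_partialPairL_pole_of_eq_conj_holds_of_le_two`) and follows in
every rank from the archimedean named fact `HumphriesJo2024_archRankinSelberg_testVector n K`
(`JacquetShalika1981_partialPairL_pole_of_eq_conj_of_humphriesJo'`, `PairLFunctionPolesEqConjOfHumphriesJo`: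
Humphries–Jo test vectors, Landau's lemma, the one-family reduction).  This file assembles the three:

* `JacquetShalika1981_partialPairL_pole_repData_rank_of_humphriesJo` — (2.3) for Borel–Jacquet data in
  rank `n` over `F` from `3 ≤ n → HumphriesJo2024_archRankinSelberg_testVector n F` (nothing in ranks `≤ 2`);
* `JacquetShalika1981_partialPairL_pole_repData_of_humphriesJo_three_le` (**main**) — the named fact
  in every rank from the Humphries–Jo fact in ranks `≥ 3` over every number field;
* `JacquetShalika1981_partialPairL_pole_repData_of_humphriesJo` — the same from the Humphries–Jo fact in
  all ranks (the shape registered as `stub_humphriesJo` by the `PairLBoundaryJS` line).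

So every consumer of (2.3) for Borel–Jacquet data (isobaric rigidity for the Langlands route: cruxes
`IrreducibleOffSector`, `ReciprocityUpToIrreducibility`) hangs on ONE archimedean local statement,
Humphries–Jo (2024) Thm. 1.1 / 5.6 in ranks `≥ 3`, and on nothing else unproved.

References: J. Arthur, L. Clozel, Ann. of Math. Stud. 120 (1989), Ch. 3 §2 (2.3), p. 171
[ArthurClozelAMS120]; H. Jacquet, J. Shalika, Amer. J. Math. 103 (1981) [JacquetShalikaAJM1981],
II Prop. 3.6 [JacquetShalikaAJM1981II]; P. Humphries, Y. Jo, Math. Z. (2024), Thm. 1.1, Thm. 5.6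
[HumphriesJo2024].
-/

noncomputable section

open MeasureTheory Filter Topology NumberField IsDedekindDomain
open scoped Topology

namespace Literature.NumberTheory.Automorphic

open AdelicGroupData

/-- **Arthur–Clozel (2.3) for Borel–Jacquet data in rank `n` over `F` from Humphries–Jo in rank `n`
over `F` (needed only when `3 ≤ n`).** For cuspidal `π`, `π'` on `GL_n(𝔸_F)` (Borel–Jacquet data),
unitary Satake families off a finite `S ⊇ S₀` and `s₀ ∈ X`, `(s - s₀) L^S(s, π ⊗ π') → c ≠ 0` as
`s → s₀⁺`: `JacquetShalika1981_partialPairL_pole_repData_rank` fed with the `L²` leaf, which is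
`JacquetShalika1981_partialPairL_pole_of_eq_conj_holds_of_le_two` in ranks `≤ 2` and
`JacquetShalika1981_partialPairL_pole_of_eq_conj_of_humphriesJo'` beyond.
[cite: ArthurClozelAMS120, Ch. 3 §2, (2.3), p. 171] [cite: JacquetShalikaAJM1981II, Prop. 3.6]
[cite: HumphriesJo2024, Thm. 1.1, Thm. 5.6] -/
theorem JacquetShalika1981_partialPairL_pole_repData_rank_of_humphriesJo
    {n : ℕ} {F : Type} [Field F] [NumberField F]
    (hHJ : 3 ≤ n → HumphriesJo2024_archRankinSelberg_testVector n F)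
    (hF : isCompact_glFiniteIntegralLevel n F) (hn : 0 < n) (π π' : CuspidalAutomorphicRepData n F hF) :
    ∃ S₀ : Set (HeightOneSpectrum (𝓞 F)), S₀.Finite ∧
      ∀ {S : Set (HeightOneSpectrum (𝓞 F))} (_hS : S.Finite) (_hS₀ : S₀ ⊆ S)
        {α β : SatakeFamily F} (_hα : ∀ w ∉ S, π.1.HasSatakeParamAt w (α w))
        (_hβ : ∀ w ∉ S, π'.1.HasSatakeParamAt w (β w))
        (_hu : ∀ w ∉ S, ‖(α w).prod‖ = 1) (_hu' : ∀ w ∉ S, ‖(β w).prod‖ = 1)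
        {s₀ : ℂ} (_hs₀ : s₀.re = 1)
        (_hX : ∀ᶠ w in cofinite,
          (α w).map (((w.residueCard : ℂ) ^ (1 - s₀)) * ·) = (β w).map (·⁻¹)),
        ∃ c : ℂ, c ≠ 0 ∧
          Tendsto (fun s => (s - s₀) * partialPairL S α β s) (𝓝[{s : ℂ | 1 < s.re}] s₀) (𝓝 c) := by
  by_cases h2 : n ≤ 2
  · exact JacquetShalika1981_partialPairL_pole_repData_rank_of_le_two h2 hF hn π π'
  · exact JacquetShalika1981_partialPairL_pole_repData_rank
      (fun μ _ => JacquetShalika1981_partialPairL_pole_of_eq_conj_of_humphriesJo' (μ := μ) (hHJ (by omega)))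
      hF hn π π'

/-- **Arthur–Clozel (2.3) for Borel–Jacquet data, every rank and every number field, from the
Humphries–Jo archimedean test-vector fact in ranks `≥ 3`** (ranks `≤ 2` are theorems of the tree).
[cite: ArthurClozelAMS120, Ch. 3 §2, (2.3), p. 171] [cite: JacquetShalikaAJM1981II, Prop. 3.6]
[cite: HumphriesJo2024, Thm. 1.1, Thm. 5.6] -/
theorem JacquetShalika1981_partialPairL_pole_repData_of_humphriesJo_three_le
    (hHJ : ∀ (N : ℕ) (K : Type) [Field K] [NumberField K],
      3 ≤ N → HumphriesJo2024_archRankinSelberg_testVector N K) :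
    JacquetShalika1981_partialPairL_pole_repData :=
  fun n F _ _ hF hn π π' =>
    JacquetShalika1981_partialPairL_pole_repData_rank_of_humphriesJo (hHJ n F) hF hn π π'

/-- **Arthur–Clozel (2.3) for Borel–Jacquet data from the Humphries–Jo fact in all ranks** (the
hypothesis in the shape `∀ n K, HumphriesJo2024_archRankinSelberg_testVector n K`; only its ranks `≥ 3`
are used). [cite: ArthurClozelAMS120, Ch. 3 §2, (2.3), p. 171] [cite: HumphriesJo2024, Thm. 1.1, Thm. 5.6] -/
theorem JacquetShalika1981_partialPairL_pole_repData_of_humphriesJo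
    (hHJ : ∀ (N : ℕ) (K : Type) [Field K] [NumberField K],
      HumphriesJo2024_archRankinSelberg_testVector N K) :
    JacquetShalika1981_partialPairL_pole_repData :=
  JacquetShalika1981_partialPairL_pole_repData_of_humphriesJo_three_le fun N K _ _ _ => hHJ N K

end Literature.NumberTheory.Automorphic

end
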